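import Summits.QuantumFields.YangMills.Theses.SlowBitWindow
import Summits.QuantumFields.YangMills.Theorems.SlowBitWindowInsertionTraceSpectral
import HarnessLib

/-!
# SlowBitWindow — the support item `TraceDoor` (stmt-QuantumFields-23273), proved

`traceDoor_proof : Theses.SlowBitWindow.TraceDoor`: for `L ≥ 2`, `β ≥ 1` and every physical observable `O` with `|O| ≤ 1` that is ODD
under the spatial axis swap `(0 1)`, the antipodal two-insertion zero-flux thermal trace obeys
`insTrace L β O L ≤ 2 · λ₁(β,L)^L · Z_phys(L, β, L)`, `λ₁ = levelValue su2Rep L β 1`.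

Proof (D-0145 LINE g10-A of seat ym-idea-4, the planner's sketch made rigorous).  By the spectral representation
`insTrace_spectral` (companion module), `insTrace L β O L = Σ_{(k,l)} λ_k^L λ_l^L c_{kl}` with `c_{kl} = (∫ O e_k e_l)² ≥ 0`,
`Σ_l c_{kl} ≤ 1`, along the complete physical eigenbasis `e_k` (`λ_k = levelValue k`).  The vacuum `e_0` is a raw vacuum, hence invariant
under axis permutations (`rawVacuum_comp_configPerm`, Jentzsch), so `∫ O e_0² = 0` for odd `O` and `c_{00} = 0`; `λ_k ≤ λ_1` for
`k ≥ 1` (`levelValue_antitone`) gives the TERMWISE bound `λ_k^L λ_l^L c_{kl} ≤ λ_1^L (λ_k^L + λ_l^L) c_{kl}`, and summing with the row bound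
`Σ_l c_{kl} ≤ 1` (both orders, `c` symmetric) and the trace formula `Σ_k λ_k^L = Z_phys(L)` (`TT.traceFormula_all`) gives the claim.
Helper `summable_mul_row_le` (a row-bounded non-negative double family weighted by a summable sequence) is shared with the JensenDoor module.

HONEST FRAMING: an M-sized spectral support item of a DRAFT line onto the RECORD rung K2a (`ThermalTraceWindow.SubFemtoFirstLevel`);
fixed-lattice transfer-matrix theory; no summit, no mass gap, nothing about infinite volume or the continuum is proved here.
References: [cite: ReedSimonIV1978, Thm. XIII.1]; [cite: MontvayMunster1994, §7.1]; [cite: LuscherWolff1990].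
-/

set_option autoImplicit false

noncomputable section

open MeasureTheory Filter Topology Function
open Literature.MathematicalPhysics.QuantumFieldTheory
open Literature.MathematicalPhysics.QuantumLattice
open Literature.Analysis.OperatorTheory.YMMatrixModel
open scoped BigOperators

namespace Summit.QuantumFields.YangMills.Theorems.SlowBitWindow

open Summit.QuantumFields.YangMills.Theorems.FemtoTransferGap
open Summit.QuantumFields.YangMills.Theorems.FemtoTransferGap.TT

/-! ## §1 A summation helper -/

/-- **Row-bounded double families.**  If `a_k ≥ 0` has sum `A`, `c_{kl} ≥ 0` and every row sum `Σ_l c_{kl} ≤ B`, then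
`(k,l) ↦ a_k c_{kl}` is summable on `ℕ × ℕ` with `Σ a_k c_{kl} ≤ A · B`. [folklore] -/
theorem summable_mul_row_le {a : ℕ → ℝ} {c : ℕ → ℕ → ℝ} {A B : ℝ} (ha0 : ∀ k, 0 ≤ a k) (ha : HasSum a A)
    (hc0 : ∀ k l, 0 ≤ c k l) (hc : ∀ k, Summable (c k) ∧ ∑' l, c k l ≤ B) :
    Summable (fun p : ℕ × ℕ => a p.1 * c p.1 p.2) ∧ ∑' p : ℕ × ℕ, a p.1 * c p.1 p.2 ≤ A * B := by
  have hB : 0 ≤ B := le_trans (tsum_nonneg (hc0 0)) (hc 0).2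
  have hrow : ∀ k, HasSum (fun l => a k * c k l) (a k * ∑' l, c k l) := fun k => ((hc k).1.hasSum).mul_left (a k)
  have hg0 : ∀ k, 0 ≤ a k * ∑' l, c k l := fun k => mul_nonneg (ha0 k) (tsum_nonneg (hc0 k))
  have hgle : ∀ k, a k * ∑' l, c k l ≤ a k * B := fun k => mul_le_mul_of_nonneg_left (hc k).2 (ha0 k)
  have hgs : Summable fun k => a k * ∑' l, c k l := Summable.of_nonneg_of_le hg0 hgle (ha.summable.mul_right B)
  have hF0 : ∀ p : ℕ × ℕ, 0 ≤ a p.1 * c p.1 p.2 := fun p => mul_nonneg (ha0 _) (hc0 _ _)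
  have hF : Summable (fun p : ℕ × ℕ => a p.1 * c p.1 p.2) := by
    refine (summable_prod_of_nonneg hF0).mpr ⟨fun k => (hrow k).summable, ?_⟩
    exact hgs.congr fun k => ((hrow k).tsum_eq).symm
  refine ⟨hF, ?_⟩
  have h1 : HasSum (fun k => a k * ∑' l, c k l) (∑' p : ℕ × ℕ, a p.1 * c p.1 p.2) := hF.hasSum.prod_fiberwise hrow
  rw [← h1.tsum_eq]
  calc ∑' k, a k * ∑' l, c k l ≤ ∑' k, a k * B := hgs.tsum_le_tsum hgle (ha.summable.mul_right B)
    _ = A * B := by rw [tsum_mul_right, ha.tsum_eq]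

/-! ## §2 The door -/

/-- **`TraceDoor` holds** (item stmt-QuantumFields-23273 of route `SlowBitWindow`): for `L ≥ 2`, `β ≥ 1` and a physical, bounded-by-one,
swap-odd observable `O`, `insTrace L β O L ≤ 2 · (levelValue su2Rep L β 1)^L · physTrace L β L`. [cite: ReedSimonIV1978, Thm. XIII.1]
[cite: MontvayMunster1994, §7.1] -/
theorem traceDoor_proof : Summit.QuantumFields.YangMills.Theses.SlowBitWindow.TraceDoor := by
  intro L _ hL β hβ O hO hOb hodd
  have hβ0 : 0 < β := zero_lt_one.trans_le hβ
  obtain ⟨e, hphys, -, -, hperm, hbessel, hsum⟩ := insTrace_spectral (L := L) hβ0 hO (CO := 1) hOb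
  -- notation
  set lam : ℕ → ℝ := fun k => levelValue su2Rep L β k with hlamdef
  set c : ℕ → ℕ → ℝ := fun k l => (∫ U, O U * e k U * e l U ∂configMeasure FemtoTransferGap.SU2 L) ^ 2 with hcdef
  set a : ℕ → ℝ := fun k => lam k ^ L with hadef
  set μ1 : ℝ := lam 1 ^ L with hμ1
  have hlam0 : ∀ k, 0 ≤ lam k := fun k => (levelValue_su2Rep_pos hβ0 k).le
  have ha0 : ∀ k, 0 ≤ a k := fun k => pow_nonneg (hlam0 k) L
  have hμ1_0 : 0 ≤ μ1 := pow_nonneg (hlam0 1) L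
  have hc0 : ∀ k l, 0 ≤ c k l := fun k l => sq_nonneg _
  have hcsymm : ∀ k l, c k l = c l k := fun k l => by
    simp only [hcdef]; congr 1; exact integral_congr_ae (ae_of_all _ fun U => by ring)
  have hbessel' : ∀ k, Summable (c k) ∧ ∑' l, c k l ≤ 1 := fun k => by
    have h := hbessel k; rw [one_pow] at h; exact h
  -- `a_k ≤ μ1` for `k ≥ 1`
  have hale : ∀ k, 1 ≤ k → a k ≤ μ1 := fun k hk =>
    pow_le_pow_left₀ (hlam0 k) (KTRCalibration.levelValue_antitone (L := L) hβ0.le hk) L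
  -- `c 0 0 = 0`: the vacuum is swap-invariant, `O` is swap-odd
  have hc00 : c 0 0 = 0 := by
    simp only [hcdef]
    have hI : ∫ U, O U * e 0 U * e 0 U ∂configMeasure FemtoTransferGap.SU2 L = -∫ U, O U * e 0 U * e 0 U ∂configMeasure FemtoTransferGap.SU2 L := by
      conv_lhs => rw [← (measurePreserving_configPerm' (L := L) (Equiv.swap 0 1)).integral_comp' (f := configPerm (Equiv.swap 0 1))
        (fun U => O U * e 0 U * e 0 U)]
      rw [← integral_neg]
      refine integral_congr_ae (ae_of_all _ fun U => ?_)
      dsimp only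
      rw [hodd U, hperm (Equiv.swap 0 1) U]
      ring
    have h0 : ∫ U, O U * e 0 U * e 0 U ∂configMeasure FemtoTransferGap.SU2 L = 0 := by linarith
    rw [h0]; ring
  -- the trace formula `Σ_k λ_k^L = Z(L)`
  have htr : HasSum a (physTrace L β L) := traceFormula L β L hβ hL
  -- the double spectral sum for `m = L`
  have hF : HasSum (fun p : ℕ × ℕ => a p.1 * a p.2 * c p.1 p.2) (insTrace L β O L) := by
    have h := hsum L (by omega) (by omega)
    refine h.congr_fun fun p => ?_
    simp only [hadef, hlamdef, hcdef, show 2 * L - L = L by omega]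
  -- termwise domination
  have hdom : ∀ p : ℕ × ℕ, a p.1 * a p.2 * c p.1 p.2 ≤ μ1 * (a p.1 * c p.1 p.2) + μ1 * (a p.2 * c p.1 p.2) := by
    rintro ⟨k, l⟩
    dsimp only
    rcases Nat.eq_zero_or_pos l with hl | hl
    · rcases Nat.eq_zero_or_pos k with hk | hk
      · subst hk; subst hl; rw [hc00]; simp
      · have h1 : a k * a 0 * c k 0 ≤ μ1 * (a 0 * c k 0) := by
          subst hl
          have := hale k hk
          nlinarith [ha0 0, hc0 k 0, mul_nonneg (ha0 0) (hc0 k 0)]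
        subst hl
        nlinarith [mul_nonneg hμ1_0 (mul_nonneg (ha0 k) (hc0 k 0))]
    · have h1 : a k * a l * c k l ≤ μ1 * (a k * c k l) := by
        have := hale l hl
        nlinarith [ha0 k, hc0 k l, mul_nonneg (ha0 k) (hc0 k l)]
      nlinarith [mul_nonneg hμ1_0 (mul_nonneg (ha0 l) (hc0 k l))]
  -- the two dominating families
  obtain ⟨hS1, hS1le⟩ := summable_mul_row_le ha0 htr hc0 hbessel'
  have hcT : ∀ l, Summable (fun k => c k l) ∧ ∑' k, c k l ≤ 1 := fun l => by
    have h := hbessel' l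
    have hfun : (fun k => c k l) = c l := funext fun k => hcsymm k l
    rw [hfun]; exact h
  have hS2 : Summable (fun p : ℕ × ℕ => a p.2 * c p.1 p.2) := by
    have h := (Equiv.prodComm ℕ ℕ).summable_iff.mpr hS1
    refine h.congr fun p => ?_
    simp only [Function.comp_apply, Equiv.prodComm_apply, Prod.fst_swap, Prod.snd_swap, hcsymm p.2 p.1]
  have hS2le : ∑' p : ℕ × ℕ, a p.2 * c p.1 p.2 ≤ physTrace L β L * 1 := by
    have h : ∑' p : ℕ × ℕ, a p.2 * c p.1 p.2 = ∑' p : ℕ × ℕ, a p.1 * c p.1 p.2 := by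
      rw [← (Equiv.prodComm ℕ ℕ).tsum_eq]
      refine tsum_congr fun p => ?_
      simp only [Equiv.prodComm_apply, Prod.fst_swap, Prod.snd_swap, hcsymm p.2 p.1]
    rw [h]; exact hS1le
  have hG : HasSum (fun p : ℕ × ℕ => μ1 * (a p.1 * c p.1 p.2) + μ1 * (a p.2 * c p.1 p.2))
      (μ1 * ∑' p : ℕ × ℕ, a p.1 * c p.1 p.2 + μ1 * ∑' p : ℕ × ℕ, a p.2 * c p.1 p.2) :=
    (hS1.hasSum.mul_left μ1).add (hS2.hasSum.mul_left μ1)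
  have hle := hasSum_le hdom hF hG
  rw [mul_one] at hS1le hS2le
  calc insTrace L β O L ≤ μ1 * ∑' p : ℕ × ℕ, a p.1 * c p.1 p.2 + μ1 * ∑' p : ℕ × ℕ, a p.2 * c p.1 p.2 := hle
    _ ≤ μ1 * physTrace L β L + μ1 * physTrace L β L := by gcongr
    _ = 2 * levelValue su2Rep L β 1 ^ L * physTrace L β L := by rw [hμ1, hlamdef]; ring

end Summit.QuantumFields.YangMills.Theorems.SlowBitWindow

end
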